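import Mathlib
import Literature.Analysis.FluidPDE.TypeIAncientMild
import Literature.Analysis.FluidPDE.SelfSimilar
import Literature.Analysis.FluidPDE.ForwardDSSExtension
import Literature.Analysis.FluidPDE.ScalingUniformRecurrence
import Summits.NavierStokesRegularity.NavierStokesRegularity.Theorems.PoloidalWindowDoorPoloidalWindowRigidityStrata
import Summits.NavierStokesRegularity.NavierStokesRegularity.Theorems.PoloidalWindowDoorPoloidalWindowRigidityOneSlice
import Literature.Analysis.FluidPDE.AxisymmetricEuler
import Literature.Analysis.FluidPDE.AxisymmetricVorticityTransport
import Summits.NavierStokesRegularity.NavierStokesRegularity.Theorems.ScenarioCensusPeriodicGauge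
import HarnessLib
import Summits.NavierStokesRegularity.NavierStokesRegularity.Theorems.ScenarioCensusRotationOrderAxis

/-!
# Census rows D7 / R4, the SCALING-SPECTRUM meter — LINE «scaling-spectrum» port, part 1/3: the log-scaling group, rows `Row_DdenseT` /
# `Row_DbiT` / `Row_DncT` PROVED, the lattice-spectrum display

Re-homed for the scenario census (typer seat ns-census-typer-1 g7; the cells are MEMBERS OF RECORD «DECIDED IN KERNEL IN FILES» of rows D7 / R4
since census v1.68 (lead g9; critic idea-crit-3 PASS + RE-STAMP 19:11:46Z; ref ns-census-ref g8 PRE-CHECK ✓ §13.14 [1/6]; lit §21.20); this port makes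
them TREE-decided): VERBATIM PORT of ns-idea-2 LINE g11-1 «scaling-spectrum» REV 2, `pub/ideators/ns-idea-2/lines/scaling-spectrum/line-scaling-spectrum.lean`
sha16 ae596ee6747cac4b (756 l., lean check rc 0, 0 sorry), split for the 400-line rule into `ScenarioCensusScalingSpectrum` (the log-scaling group, rows
`Row_DdenseT` / `Row_DbiT` / `Row_DncT` + `_holds`, `row_DbiT_of_row_DncT`, the lattice-spectrum display) → `…ScalingSpectrumCentre` (DSS about two centres:
`Row_D2cT` + `_holds`, `atMostOneCentre_of_nontrivial`) → `…ScalingSpectrumRotated` (REV 2: rotated DSS `Row_R2cT`, the apex `Row_DapT` + `_holds`; census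
KEYS).  Lean text VERBATIM in namespace `…Theorems.ScenarioCensus.ScalingSpectrum` (the line's `…Lines.ScalingSpectrum` re-homed); port edits: `local notation
"E3"` → `abbrev E3`, `[folklore]` dropped from the docstrings of the six parameterless row `def`s (gate relocation rule), fourteen one-line docstrings added, lemmas that restate already-landed tree declarations taken BY NAME (gate lint `dedup.landed`): `not_cyclic_of_irrational` = `RotationOrder.not_cyclic_of_irrational`, `rotZ_neg_rotZ` = `RotationOrder.rotZ_neg_rotZ`, `rotZ_rotZ_neg` = `RotationOrder.rotZ_rotZ_neg`, `rotZ_add_vec` = `ScrewBlowdown.rotZ_add_vec`, `rotZ_neg_vec` = `RotationOrder.rotZ_neg_vec`, `rotZ_sub_vec` = `ScrewBlowdown.rotZ_sub_vec`, `rotZ_comm` = `RotationOrder.rotZ_comm`;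
REV 2's «copies of the rotation-order helpers» are not re-declared where the tree already has them (gate lint `dedup.landed`): taken BY NAME from
`…ScenarioCensus.RotationOrder` / `…ScrewBlowdown`, and `rotZ_smul_vec` (tree twin in a non-importable theses-cone module) is a local `have` at its two
use sites (proof-only diffs).

No census VALUE is moved here (rows D7 / R4 keep their values; the members become TREE-decided by name); NS regularity is NOT proved; no summit
statement is proved by this file.
-/

noncomputable section

-- the summit and its single problem share the name `NavierStokesRegularity` (D-0017 nested layout)
set_option linter.dupNamespace false

open Set Function Filter Topology

namespace Summit.NavierStokesRegularity.NavierStokesRegularity.Theorems.ScenarioCensus.ScalingSpectrum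

open Literature.Analysis Literature.Analysis.FluidPDE
open Summit.NavierStokesRegularity.NavierStokesRegularity.Theorems.PoloidalWindowDoorPoloidalWindowRigidityStrata
  (eq_zero_of_scaleInvariant)
open Summit.NavierStokesRegularity.NavierStokesRegularity.Theorems.PoloidalWindowDoorPoloidalWindowRigidityOneSlice
  (eq_zero_of_translate_eq_slice)

/-! ### The instrument: the scaling spectrum as an additive subgroup of `ℝ` -/

/-- The **scaling spectrum in logarithmic scale**: `𝔊(u) = {σ | u is e^σ-DSS}`, an additive subgroup
of `ℝ` (identity `nsRescale_one`, group law `IsDiscretelySelfSimilar.mul`, inverses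
`BradshawTsai2019.isDiscretelySelfSimilar_inv`). -/
def logScalingGroup (u : ℝ → EuclideanSpace ℝ (Fin 3) → EuclideanSpace ℝ (Fin 3)) : AddSubgroup ℝ where
  carrier := {σ | IsDiscretelySelfSimilar (Real.exp σ) u}
  zero_mem' := by
    show IsDiscretelySelfSimilar (Real.exp 0) u
    rw [Real.exp_zero]
    exact nsRescale_one u
  add_mem' := by
    intro a b ha hb
    show IsDiscretelySelfSimilar (Real.exp (a + b)) u
    rw [Real.exp_add]
    exact IsDiscretelySelfSimilar.mul ha hb
  neg_mem' := by
    intro a ha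
    show IsDiscretelySelfSimilar (Real.exp (-a)) u
    rw [Real.exp_neg]
    exact BradshawTsai2019.isDiscretelySelfSimilar_inv (Real.exp_pos a).ne' ha

/-- Membership in the log-scaling group, unfolded. -/
theorem mem_logScalingGroup {u : ℝ → EuclideanSpace ℝ (Fin 3) → EuclideanSpace ℝ (Fin 3)} {σ : ℝ} :
    σ ∈ logScalingGroup u ↔ IsDiscretelySelfSimilar (Real.exp σ) u :=
  Iff.rfl

/-- A positive factor `c` is a scaling symmetry iff `log c` lies in the scaling spectrum. -/
theorem log_mem_logScalingGroup_iff {u : ℝ → EuclideanSpace ℝ (Fin 3) → EuclideanSpace ℝ (Fin 3)}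
    {c : ℝ} (hc : 0 < c) : Real.log c ∈ logScalingGroup u ↔ IsDiscretelySelfSimilar c u := by
  rw [mem_logScalingGroup, Real.exp_log hc]

/-- Self-similar fields have full spectrum `𝔊 = ℝ`. -/
theorem logScalingGroup_eq_top_of_isSelfSimilar
    {u : ℝ → EuclideanSpace ℝ (Fin 3) → EuclideanSpace ℝ (Fin 3)} (h : IsSelfSimilar u) :
    logScalingGroup u = ⊤ := by
  ext σ
  simp only [mem_logScalingGroup, AddSubgroup.mem_top, iff_true]
  exact h.isDiscretelySelfSimilar (Real.exp_pos σ)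

/-- The zero field has full spectrum (the conclusion of every row is consistent). -/
theorem logScalingGroup_zero :
    logScalingGroup (0 : ℝ → EuclideanSpace ℝ (Fin 3) → EuclideanSpace ℝ (Fin 3)) = ⊤ := by
  ext σ
  simp only [mem_logScalingGroup, AddSubgroup.mem_top, iff_true]
  show nsRescale (Real.exp σ) (0 : ℝ → EuclideanSpace ℝ (Fin 3) → EuclideanSpace ℝ (Fin 3)) = 0
  exact nsRescale_zero_field _

/-! ### The rows (census D-block cells over `IsTypeIAncientMild` by name) -/

/-- ROW D-dense-T: a Type-I ancient mild field in the KNSS gauge whose scaling spectrum is dense in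
`ℝ` vanishes on the past. -/
def Row_DdenseT : Prop :=
  ∀ (C : ℝ) (u : ℝ → EuclideanSpace ℝ (Fin 3) → EuclideanSpace ℝ (Fin 3)),
    IsTypeIAncientMild C u → Dense (logScalingGroup u : Set ℝ) → ∀ t < 0, ∀ x, u t x = 0

/-- ROW D-bi-T («bi-DSS»): a Type-I ancient mild field in the KNSS gauge that is discretely
self-similar with respect to two factors `c, d > 0` with `log c / log d` irrational (e.g. `2` and
`3`) vanishes on the past — at ANY Type-I constant, with no envelope and no threshold. -/
def Row_DbiT : Prop :=
  ∀ (C : ℝ) (u : ℝ → EuclideanSpace ℝ (Fin 3) → EuclideanSpace ℝ (Fin 3)) (c d : ℝ),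
    IsTypeIAncientMild C u → 0 < c → 0 < d → Irrational (Real.log c / Real.log d) →
    IsDiscretelySelfSimilar c u → IsDiscretelySelfSimilar d u → ∀ t < 0, ∀ x, u t x = 0

/-- ROW D-nc-T: a Type-I ancient mild field in the KNSS gauge whose scaling spectrum is NOT a cyclic
subgroup `(log λ₀)ℤ` vanishes on the past. -/
def Row_DncT : Prop :=
  ∀ (C : ℝ) (u : ℝ → EuclideanSpace ℝ (Fin 3) → EuclideanSpace ℝ (Fin 3)),
    IsTypeIAncientMild C u → (∀ a : ℝ, logScalingGroup u ≠ AddSubgroup.zmultiples a) →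
    ∀ t < 0, ∀ x, u t x = 0

/-! ### Dense spectrum ⇒ scale invariance on the past -/

/-- The orbit map of the scaling flow at a past point is continuous in the log-scale. -/
theorem continuous_orbit {u : ℝ → EuclideanSpace ℝ (Fin 3) → EuclideanSpace ℝ (Fin 3)}
    (hcont : ContinuousOn (uncurry u) (Iio (0 : ℝ) ×ˢ univ)) {s : ℝ} (hs : s < 0)
    (y : EuclideanSpace ℝ (Fin 3)) :
    Continuous fun σ : ℝ => Real.exp σ • u (Real.exp σ ^ 2 * s) (Real.exp σ • y) := by
  have hpath : Continuous fun σ : ℝ => (Real.exp σ ^ 2 * s, Real.exp σ • y) := by fun_prop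
  have hmaps : ∀ σ : ℝ, (Real.exp σ ^ 2 * s, Real.exp σ • y) ∈ Iio (0 : ℝ) ×ˢ (univ : Set (EuclideanSpace ℝ (Fin 3))) := by
    intro σ
    refine ⟨?_, mem_univ _⟩
    exact mul_neg_of_pos_of_neg (pow_pos (Real.exp_pos σ) 2) hs
  have hcomp : Continuous fun σ : ℝ => uncurry u (Real.exp σ ^ 2 * s, Real.exp σ • y) :=
    hcont.comp_continuous hpath hmaps
  exact Real.continuous_exp.smul hcomp

/-- **Dense scaling spectrum ⇒ scale invariance on the past**: if `𝔊(u)` is dense and `u` is jointly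
continuous on `{t < 0}`, then `λ u(λ²s, λy) = u(s, y)` for every `λ > 0`, `s < 0`, `y`. -/
theorem scaleInvariant_of_dense {u : ℝ → EuclideanSpace ℝ (Fin 3) → EuclideanSpace ℝ (Fin 3)}
    (hcont : ContinuousOn (uncurry u) (Iio (0 : ℝ) ×ˢ univ))
    (hD : Dense (logScalingGroup u : Set ℝ)) :
    ∀ lam : ℝ, 0 < lam → ∀ s < 0, ∀ y, lam • u (lam ^ 2 * s) (lam • y) = u s y := by
  intro lam hlam s hs y
  set Φ : ℝ → EuclideanSpace ℝ (Fin 3) := fun σ => Real.exp σ • u (Real.exp σ ^ 2 * s) (Real.exp σ • y)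
    with hΦ
  have hΦc : Continuous Φ := continuous_orbit hcont hs y
  have hclosed : IsClosed {σ : ℝ | Φ σ = u s y} := isClosed_eq hΦc continuous_const
  have hsub : (logScalingGroup u : Set ℝ) ⊆ {σ : ℝ | Φ σ = u s y} := by
    intro σ hσ
    have h : nsRescale (Real.exp σ) u = u := hσ
    have h' := congrFun (congrFun h s) y
    rw [nsRescale_apply] at h'
    exact h'
  have hall : {σ : ℝ | Φ σ = u s y} = univ := by
    have h1 := hclosed.closure_subset_iff.2 hsub
    rw [hD.closure_eq] at h1
    exact eq_univ_of_univ_subset h1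
  have hmem : Real.log lam ∈ {σ : ℝ | Φ σ = u s y} := by rw [hall]; exact mem_univ _
  have e : Φ (Real.log lam) = u s y := hmem
  simpa only [hΦ, Real.exp_log hlam] using e

/-! ### The rows hold -/

/-- **ROW D-dense-T holds** (files-only kernel proof). -/
theorem row_DdenseT_holds : Row_DdenseT := by
  intro C u hu hD
  exact eq_zero_of_scaleInvariant hu.hasTypeITimeDecay hu.continuousOn_uncurry
    (fun s t hst ht x => hu.mild_eq_heatExtension hst ht x) (fun t ht => hu.isDivFree ht)
    (scaleInvariant_of_dense hu.continuousOn_uncurry hD)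

/-- Non-cyclic subgroups of `ℝ` are dense (Mathlib). -/
theorem dense_of_not_cyclic {G : AddSubgroup ℝ} (h : ∀ a : ℝ, G ≠ AddSubgroup.zmultiples a) :
    Dense (G : Set ℝ) :=
  AddSubgroup.dense_iff_ne_zmultiples.2 h

/-- **ROW D-nc-T holds.** -/
theorem row_DncT_holds : Row_DncT :=
  fun C u hu hnc => row_DdenseT_holds C u hu (dense_of_not_cyclic hnc)

-- `not_cyclic_of_irrational`: the line restates the tree's `RotationOrder.not_cyclic_of_irrational`; taken BY NAME (gate lint dedup.landed).

/-- **ROW D-bi-T holds** («bi-DSS profiles are trivial»). -/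
theorem row_DbiT_holds : Row_DbiT := by
  intro C u c d hu hc hd hirr hcu hdu
  refine row_DncT_holds C u hu (RotationOrder.not_cyclic_of_irrational (p := Real.log c) (q := Real.log d) ?_ ?_ hirr)
  · exact (log_mem_logScalingGroup_iff hc).2 hcu
  · exact (log_mem_logScalingGroup_iff hd).2 hdu

/-- Lattice of the rows: the non-cyclic row implies the bi-DSS row (formal). -/
theorem row_DbiT_of_row_DncT (h : Row_DncT) : Row_DbiT := fun C u _ _ hu hc hd hirr hcu hdu =>
  h C u hu (RotationOrder.not_cyclic_of_irrational ((log_mem_logScalingGroup_iff hc).2 hcu)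
    ((log_mem_logScalingGroup_iff hd).2 hdu) hirr)

/-! ### The display: LATTICE SPECTRUM of non-trivial profiles -/

/-- **The scaling spectrum of a non-trivial Type-I ancient mild field is a lattice** `(log λ₀)ℤ`
(`λ₀ = 1` allowed: no scaling symmetry). Census reading: beyond the self-similar (D1–D4) and the
ONE-factor DSS cells (D5–D7) there is NO further scaling-symmetric scenario. -/
theorem latticeSpectrum_of_nontrivial {C : ℝ}
    {u : ℝ → EuclideanSpace ℝ (Fin 3) → EuclideanSpace ℝ (Fin 3)} (hu : IsTypeIAncientMild C u)
    (hne : ∃ t < 0, ∃ x, u t x ≠ 0) : ∃ a : ℝ, logScalingGroup u = AddSubgroup.zmultiples a := by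
  by_contra h
  push Not at h
  obtain ⟨t, ht, x, hx⟩ := hne
  exact hx (row_DncT_holds C u hu h t ht x)

/-- Example: a `2`-DSS and `3`-DSS Type-I ancient mild field is trivial (`log 2 / log 3 ∉ ℚ` is the
caller's arithmetic input; stated with the hypothesis explicit). -/
example {C : ℝ} {u : ℝ → EuclideanSpace ℝ (Fin 3) → EuclideanSpace ℝ (Fin 3)}
    (hu : IsTypeIAncientMild C u) (h2 : IsDiscretelySelfSimilar 2 u) (h3 : IsDiscretelySelfSimilar 3 u)
    (hirr : Irrational (Real.log 2 / Real.log 3)) : ∀ t < 0, ∀ x, u t x = 0 :=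
  row_DbiT_holds C u 2 3 hu two_pos three_pos hirr h2 h3

end Summit.NavierStokesRegularity.NavierStokesRegularity.Theorems.ScenarioCensus.ScalingSpectrum

end
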